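import Summits.ResolutionOfSingularities.ResolutionOfSingularities.Theorems.PurelyInseparableDim4ChartCentreIntegral
import Summits.ResolutionOfSingularities.ResolutionOfSingularities.Theorems.PurelyInseparableDim4ChartCentreEscape
import HarnessLib

/-!
# Purely inseparable four-folds `z^p + F(x₁, …, x₄)`: the DEPTH-THREE HISTORY CRITERION, escape half — when
# the walk's third coordinate centre, read on a chart of a chart, is NOT closed in the twice blown-up ambient
# (brick TY-2 g3 (a2), part 1, of cell `res-dim4-pi`)

[OURS · counted 0] (D-0157 DOOR 2; director-resolution DR-157-C; desk WORD #66 (4); frame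
`PIDim4.TerminationImpliesOrderReduction`, S3 (c) coordinate regime). Sequel of
`PurelyInseparableDim4ChartCentreIntegral.lean` (closedness = integrality, any depth). SETTING: blow up
`𝔸⁵_K = Spec K[z, x₁, …, x₄]` along `V(z, x_S)` (`π : W → 𝔸⁵`), pass to the `x_j`-chart re-centred at the point
`b` (`j ∈ S`, `b_j = 0`; `Θ xᵢ = xᵢ + bᵢ`, `Θ` fixing constants, `Θ z` arbitrary — cleaning included); there the
walk's SECOND centre `V(z, x_{S'})` with `S.erase j ⊆ S'` is closed in `W` (typ-2 g2,
`isClosed_image_CΛ_chart_iff`); blow it up (`π₂ : W₂ → W`, any blowing up of the global centre), pass to the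
`x_{j'}`-chart re-centred at `b'` (`j' ∈ S'`, `b'_{j'} = 0`, `Θ'`), and let `V(z, x_{S''})` with
`S'.erase j' ⊆ S'' ∌ j'` be the walk's THIRD centre. By `isClosed_image_CΛ_chart_of_chart_iff` its chart image is
closed in `W₂` iff `K[z, x] —Θ'ψ_{j'}Θψ_j→ K[z, x] → K[z, x]/(z, x_{S''})` is an integral ring map. PROVED here
(no `sorry`, no new axiom):

* §1 two algebra devices: `quotient_comp_surjective_of_X` (a constant-fixing `Φ : K[x] → K[x]` followed by
  `K[x] → K[x]/I` is onto as soon as every variable residue is hit) and `not_isIntegral_quotient_comp_of_witness`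
  (ESCAPE PRINCIPLE: a ring map `χ : K[x] → L` killing `I`, with `χ ∘ Φ` factoring through an integrally closed
  domain `R ⊂ L = Frac R` while `χ a ∉ R` for some `a`, shows `K[x] —Φ→ K[x] → K[x]/I` is not integral);
  `IΛ_le_ker_of_X`;
* §2 the values of the one-step substitution `Θ ∘ ψ_j` on the variables (`clean_subst_X_chart/fibre/base/zero`);
* §3 **`not_isIntegral_depth_three`** — ESCAPE: if `j' ∈ S.erase j` (the new chart direction is an OLD
  FIBRE direction), `b'_k = 0` for every `k ∈ S' ∖ S` (the point lies on the strict transforms of the base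
  hyperplanes through which the second centre was cut) and `j ∈ S'' → b'_j = 0` (on the strict transform of
  the first exceptional divisor when the third centre is in it), then the composite is NOT integral — witness
  the `K(t)`-point `x_{j'} = t⁻¹`, `x_j = −b'_j`, all other coordinates `0`, along which every ORIGINAL
  coordinate of `𝔸⁵` is the constant `(0, …, 0, b'_k + b_k (k ∉ S))` (the valuative picture of typ-2 g2's
  `not_isClosed_image_CΛ_chart`, one level deeper).

The closed half and the iff are `PurelyInseparableDim4ChartChainHistory.lean`. Nothing here is a statement
about resolution of singularities in dimension ≥ 4 / characteristic `p` (NOT proved anywhere in this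
programme). bears_on: LADDER-RESOLUTION:D157-DOOR2 (res-dim4-pi). Supports stmt-ResolutionOfSingularities-16155
(helper, TY-2 g3 (a2) part 1).
-/

-- every declaration of this summit lives under `Summit.ResolutionOfSingularities.ResolutionOfSingularities`
-- (summit = problem), which the duplicate-namespace linter flags; house convention (cf. the Target file).
set_option linter.dupNamespace false

noncomputable section

open MvPolynomial Finset CategoryTheory AlgebraicGeometry Opposite TopologicalSpace
open AlgebraicGeometry.Scheme.IdealSheafData (ofIdealTop vanishingIdeal)

namespace Summit.ResolutionOfSingularities.ResolutionOfSingularities.Theorems.PIDim4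

open Literature.AlgebraicGeometry.Resolution
open Literature.AlgebraicGeometry.Resolution.AffinePointBlowup (P A γ coord Wtop)

namespace ChartDictionary

/-! ## §1 Two algebra devices: surjectivity from variables, non-integrality from a witness -/

section Devices

variable {K : Type} [Field K] {σ : Type*}

/-- A constant-fixing ring endomorphism `Φ` of `K[x_σ]` followed by `K[x_σ] → K[x_σ]/I` is ONTO as soon as
the residue of every variable is in its range. -/
theorem quotient_comp_surjective_of_X {I : Ideal (MvPolynomial σ K)} {Φ : MvPolynomial σ K →+* MvPolynomial σ K}
    (hC : ∀ c : K, Φ (C c) = C c)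
    (hX : ∀ m : σ, Ideal.Quotient.mk I (X m) ∈ Set.range ((Ideal.Quotient.mk I).comp Φ)) :
    Function.Surjective ((Ideal.Quotient.mk I).comp Φ) := by
  intro y
  obtain ⟨f, rfl⟩ := Ideal.Quotient.mk_surjective y
  induction f using MvPolynomial.induction_on with
  | C c => exact ⟨C c, by rw [RingHom.comp_apply, hC]⟩
  | add p q hp hq =>
    obtain ⟨a, ha⟩ := hp
    obtain ⟨a', ha'⟩ := hq
    exact ⟨a + a', by rw [map_add, ha, ha', map_add]⟩
  | mul_X p m hp =>
    obtain ⟨a, ha⟩ := hp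
    obtain ⟨a', ha'⟩ := hX m
    exact ⟨a * a', by rw [map_mul, ha, ha', map_mul]⟩

/-- **ESCAPE PRINCIPLE.** Let `Φ` be a ring endomorphism of `K[x_σ]`, `I` an ideal, `R` an integrally closed
domain with fraction field `L`, and `χ : K[x_σ] → L` a ring map killing `I` such that `χ ∘ Φ` factors through
`R` (`χ ∘ Φ = (R → L) ∘ g`). If `χ a ∉ R` for some `a`, then `K[x_σ] —Φ→ K[x_σ] → K[x_σ]/I` is NOT an integral
ring map (the residue of `a` would be integral over `R` inside `L`, hence in `R`). -/
theorem not_isIntegral_quotient_comp_of_witness {I : Ideal (MvPolynomial σ K)}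
    {Φ : MvPolynomial σ K →+* MvPolynomial σ K} {R L : Type*} [CommRing R] [IsDomain R] [IsIntegrallyClosed R]
    [Field L] [Algebra R L] [IsFractionRing R L] (χ : MvPolynomial σ K →+* L) (hker : ∀ a ∈ I, χ a = 0)
    (g : MvPolynomial σ K →+* R) (hfac : χ.comp Φ = (algebraMap R L).comp g) {a : MvPolynomial σ K}
    (ha : χ a ∉ Set.range (algebraMap R L)) :
    ¬ ((Ideal.Quotient.mk I).comp Φ).IsIntegral := by
  intro hint
  obtain ⟨p, hp, hpa⟩ := hint (Ideal.Quotient.mk I a)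
  set χ' : MvPolynomial σ K ⧸ I →+* L := Ideal.Quotient.lift I χ hker with hχ'
  have h1 := congrArg χ' hpa
  rw [Polynomial.hom_eval₂, map_zero, hχ', Ideal.Quotient.lift_mk] at h1
  have hcomp : (Ideal.Quotient.lift I χ hker).comp ((Ideal.Quotient.mk I).comp Φ) = (algebraMap R L).comp g := by
    rw [← hfac]
    refine RingHom.ext fun f => ?_
    simp only [RingHom.comp_apply, Ideal.Quotient.lift_mk]
  rw [hcomp, ← Polynomial.eval₂_map] at h1
  have hint' : IsIntegral R (χ a) := ⟨p.map g, hp.map g, h1⟩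
  obtain ⟨y, hy⟩ := IsIntegrallyClosed.isIntegral_iff.mp hint'
  exact ha ⟨y, hy⟩

/-- A ring map `χ` out of `K[x]` kills the coordinate ideal `(xᵢ : i ∈ Λ)` as soon as it kills its
generators. -/
theorem IΛ_le_ker_of_X {n : ℕ} {L : Type*} [CommRing L] (χ : A n K →+* L) {Λ : Set (Fin (n + 1))}
    (h : ∀ m ∈ Λ, χ (X m) = 0) : ∀ a ∈ AffineCoordBlowup.IΛ n K Λ, χ a = 0 := by
  intro a ha
  have hle : AffineCoordBlowup.IΛ n K Λ ≤ RingHom.ker χ := by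
    refine Ideal.span_le.mpr ?_
    rintro _ ⟨m, hm, rfl⟩
    exact (RingHom.mem_ker).mpr (h m hm)
  exact (RingHom.mem_ker).mp (hle ha)

end Devices

/-! ## §2 The one-step substitution `Θ ∘ ψ_j` on the variables -/

section OneStep

variable {K : Type} [Field K] {S : Finset (Fin 4)} {j : Fin 4} {b : Fin 4 → K} {Θ : A 4 K →+* A 4 K}

/-- `Θψ_j (x_j) = x_j`. -/
theorem clean_subst_X_chart (hbj : b j = 0) (hs : ∀ k : Fin 4, Θ (X k.succ) = X k.succ + C (b k)) :
    Θ (coordBlowupSubst K (insert 0 (Fin.succ '' (S : Set (Fin 4)))) j.succ (X j.succ)) = X j.succ := by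
  rw [coordBlowupSubst_X_self, hs j, hbj, C_0, add_zero]

/-- `Θψ_j (xᵢ) = x_j (xᵢ + bᵢ)` for an old centre variable `i ∈ S ∖ {j}` (a fibre coordinate). -/
theorem clean_subst_X_fibre (hbj : b j = 0) (hs : ∀ k : Fin 4, Θ (X k.succ) = X k.succ + C (b k))
    {i : Fin 4} (hi : i ∈ S) (hij : i ≠ j) :
    Θ (coordBlowupSubst K (insert 0 (Fin.succ '' (S : Set (Fin 4)))) j.succ (X i.succ)) =
      X j.succ * (X i.succ + C (b i)) := by
  rw [coordBlowupSubst_X_of_mem_of_ne K _ j.succ (succ_mem_centreVars hi) (fun e => hij (Fin.succ_inj.mp e)),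
    map_mul, hs j, hbj, C_0, add_zero, hs i]

/-- `Θψ_j (x_k) = x_k + b_k` for a base variable `k ∉ S`. -/
theorem clean_subst_X_base (hs : ∀ k : Fin 4, Θ (X k.succ) = X k.succ + C (b k)) {k : Fin 4}
    (hk : k ∉ S) :
    Θ (coordBlowupSubst K (insert 0 (Fin.succ '' (S : Set (Fin 4)))) j.succ (X k.succ)) = X k.succ + C (b k) := by
  rw [coordBlowupSubst_X_of_not_mem K _ j.succ (fun hm => hk ((succ_mem_centreVars_iff S k).mp hm)), hs k]

/-- `Θψ_j (z) = x_j · Θ(z)` (whatever the cleaning `Θ z`). -/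
theorem clean_subst_X_zero (hbj : b j = 0) (hs : ∀ k : Fin 4, Θ (X k.succ) = X k.succ + C (b k)) :
    Θ (coordBlowupSubst K (insert 0 (Fin.succ '' (S : Set (Fin 4)))) j.succ (X 0)) = X j.succ * Θ (X 0) := by
  rw [coordBlowupSubst_centreVars_X_zero, map_mul, hs j, hbj, C_0, add_zero]

end OneStep

/-! ## §3 Escape at depth three -/

section DepthThree

variable {K : Type} [Field K] {S S' S'' : Finset (Fin 4)} {j j' : Fin 4} {b b' : Fin 4 → K}
  {Θ Θ' : A 4 K →+* A 4 K}

/-- **ESCAPE AT DEPTH THREE (algebra).** If the new chart direction `x_{j'}` is an old fibre direction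
(`j' ∈ S ∖ {j}`), the point `b'` lies on the strict transforms of the base hyperplanes `x_k = 0`, `k ∈ S' ∖ S`
(`b'_k = 0`), and on the strict transform of the first exceptional divisor whenever the third centre lies in
it (`j ∈ S'' → b'_j = 0`), then `K[z, x] —Θ'ψ_{j'}Θψ_j→ K[z, x] → K[z, x]/(z, x_{S''})` is NOT integral
(provided `j' ∉ S''`): along the `K(t)`-point `x_{j'} = t⁻¹`, `x_j = −b'_j`, all other coordinates `0`, every
original coordinate is CONSTANT. -/
theorem not_isIntegral_depth_three (hj : j ∈ S) (hbj : b j = 0) (hC : ∀ c : K, Θ (C c) = C c)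
    (hs : ∀ k : Fin 4, Θ (X k.succ) = X k.succ + C (b k)) (hbj' : b' j' = 0) (hC' : ∀ c : K, Θ' (C c) = C c)
    (hs' : ∀ k : Fin 4, Θ' (X k.succ) = X k.succ + C (b' k)) (hj'S'' : j' ∉ S'')
    (h1 : j' ∈ S.erase j) (h2 : ∀ k ∈ S' \ S, b' k = 0) (h3 : j ∈ S'' → b' j = 0) :
    ¬ ((Ideal.Quotient.mk (AffineCoordBlowup.IΛ 4 K (insert 0 (Fin.succ '' (S'' : Set (Fin 4)))))).comp
        ((Θ'.comp (coordBlowupSubst K (insert 0 (Fin.succ '' (S' : Set (Fin 4)))) j'.succ).toRingHom).comp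
          (Θ.comp (coordBlowupSubst K (insert 0 (Fin.succ '' (S : Set (Fin 4)))) j.succ).toRingHom))).IsIntegral := by
  obtain ⟨hj'j, hj'S⟩ := Finset.mem_erase.mp h1
  have hne : (j.succ : Fin (4 + 1)) ≠ j'.succ := fun e => hj'j (Fin.succ_inj.mp e).symm
  -- the valuation ring `R = K[t]`, its fraction field `L`, and the escaping `L`-point
  set ι : Polynomial K →+* FractionRing (Polynomial K) := algebraMap (Polynomial K) (FractionRing (Polynomial K))
    with hι
  set v : Fin (4 + 1) → FractionRing (Polynomial K) :=
    Function.update (Function.update 0 j.succ (ι (Polynomial.C (-(b' j))))) j'.succ (ι Polynomial.X)⁻¹ with hv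
  set χ : A 4 K →+* FractionRing (Polynomial K) := MvPolynomial.eval₂Hom (ι.comp Polynomial.C) v with hχ
  -- values of `χ` on the variables and the constants
  have hχj' : χ (X j'.succ) = (ι Polynomial.X)⁻¹ := by
    rw [hχ, eval₂Hom_X', hv, Function.update_self]
  have hχj : χ (X j.succ) = ι (Polynomial.C (-(b' j))) := by
    rw [hχ, eval₂Hom_X', hv, Function.update_of_ne hne, Function.update_self]
  have hχ0 : ∀ m : Fin (4 + 1), m ≠ j'.succ → m ≠ j.succ → χ (X m) = 0 := by
    intro m hm hm'
    rw [hχ, eval₂Hom_X', hv, Function.update_of_ne hm, Function.update_of_ne hm', Pi.zero_apply]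
  have hχC : ∀ c : K, χ (C c) = ι (Polynomial.C c) := by
    intro c
    rw [hχ, eval₂Hom_C, RingHom.comp_apply]
  -- `χ` kills `(z, x_{S''})`
  have hker : ∀ a ∈ AffineCoordBlowup.IΛ 4 K (insert 0 (Fin.succ '' (S'' : Set (Fin 4)))), χ a = 0 := by
    refine IΛ_le_ker_of_X χ fun m hm => ?_
    rcases hm with hm | ⟨k, hk, rfl⟩
    · rw [hm]
      exact hχ0 0 (Fin.succ_ne_zero j').symm (Fin.succ_ne_zero j).symm
    · by_cases hkj : k = j
      · subst hkj
        rw [hχj, h3 hk, neg_zero, Polynomial.C_0, map_zero]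
      · exact hχ0 _ (fun e => hj'S'' ((Fin.succ_inj.mp e) ▸ hk)) (fun e => hkj (Fin.succ_inj.mp e))
  -- constants pass through both substitutions
  have hCC : ∀ c : K, Θ' (coordBlowupSubst K (insert 0 (Fin.succ '' (S' : Set (Fin 4)))) j'.succ
      (Θ (coordBlowupSubst K (insert 0 (Fin.succ '' (S : Set (Fin 4)))) j.succ (C c)))) = C c := by
    intro c
    rw [coordBlowupSubst_C, hC, coordBlowupSubst_C, hC']
  have hC'ψ' : ∀ c : K, Θ' (coordBlowupSubst K (insert 0 (Fin.succ '' (S' : Set (Fin 4)))) j'.succ (C c)) = C c := by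
    intro c
    rw [coordBlowupSubst_C, hC']
  -- KEY: the second substitution sends `x_j` to something `χ` kills
  have hkill : χ (Θ' (coordBlowupSubst K (insert 0 (Fin.succ '' (S' : Set (Fin 4)))) j'.succ (X j.succ))) = 0 := by
    by_cases hjS' : j ∈ S'
    · rw [clean_subst_X_fibre hbj' hs' hjS' hj'j.symm, map_mul, map_add, hχj', hχj, hχC, ← map_add,
        ← Polynomial.C_add, neg_add_cancel, Polynomial.C_0, map_zero, mul_zero]
    · rw [clean_subst_X_base hs' hjS', map_add, hχj, hχC, ← map_add, ← Polynomial.C_add, neg_add_cancel,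
        Polynomial.C_0, map_zero]
  -- the second substitution sends a base variable `x_k`, `k ∉ S`, to the constant `b'_k` under `χ`
  have hbase : ∀ k : Fin 4, k ∉ S →
      χ (Θ' (coordBlowupSubst K (insert 0 (Fin.succ '' (S' : Set (Fin 4)))) j'.succ (X k.succ))) =
        ι (Polynomial.C (b' k)) := by
    intro k hkS
    have hkj : k ≠ j := fun e => hkS (e ▸ hj)
    have hkj' : k ≠ j' := fun e => hkS (e ▸ hj'S)
    by_cases hkS' : k ∈ S'
    · rw [clean_subst_X_fibre hbj' hs' hkS' hkj', map_mul, map_add, hχC,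
        hχ0 _ (fun e => hkj' (Fin.succ_inj.mp e)) (fun e => hkj (Fin.succ_inj.mp e)), zero_add,
        h2 k (Finset.mem_sdiff.mpr ⟨hkS', hkS⟩), Polynomial.C_0, map_zero, mul_zero]
    · rw [clean_subst_X_base hs' hkS', map_add, hχC,
        hχ0 _ (fun e => hkj' (Fin.succ_inj.mp e)) (fun e => hkj (Fin.succ_inj.mp e)), zero_add]
  -- hence `χ ∘ Ψ₂` is evaluation at the CONSTANT point `(0; 0 on S; b' + b off S)`
  set g : A 4 K →+* Polynomial K :=
    (Polynomial.C : K →+* Polynomial K).comp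
      (MvPolynomial.eval (Fin.cases (0 : K) (fun k => if k ∈ S then 0 else b' k + b k))) with hg
  have hgC : ∀ c : K, g (C c) = Polynomial.C c := by
    intro c
    rw [hg, RingHom.comp_apply, eval_C]
  have hg0 : g (X 0) = 0 := by
    rw [hg, RingHom.comp_apply, eval_X, Fin.cases_zero, Polynomial.C_0]
  have hgS : ∀ k : Fin 4, k ∈ S → g (X k.succ) = 0 := by
    intro k hk
    rw [hg, RingHom.comp_apply, eval_X, Fin.cases_succ, if_pos hk, Polynomial.C_0]
  have hgb : ∀ k : Fin 4, k ∉ S → g (X k.succ) = Polynomial.C (b' k + b k) := by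
    intro k hk
    rw [hg, RingHom.comp_apply, eval_X, Fin.cases_succ, if_neg hk]
  have hfac : χ.comp
      ((Θ'.comp (coordBlowupSubst K (insert 0 (Fin.succ '' (S' : Set (Fin 4)))) j'.succ).toRingHom).comp
        (Θ.comp (coordBlowupSubst K (insert 0 (Fin.succ '' (S : Set (Fin 4)))) j.succ).toRingHom)) = ι.comp g := by
    refine MvPolynomial.ringHom_ext (fun c => ?_) (fun m => ?_)
    · simp only [RingHom.comp_apply, AlgHom.toRingHom_eq_coe, AlgHom.coe_toRingHom]
      rw [hCC, hχC, hgC]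
    · simp only [RingHom.comp_apply, AlgHom.toRingHom_eq_coe, AlgHom.coe_toRingHom]
      refine Fin.cases ?_ (fun k => ?_) m
      · -- `z ↦ x_j Θ(z) ↦ Θ'ψ'(x_j) · … ↦ 0`
        rw [clean_subst_X_zero hbj hs, map_mul, map_mul, map_mul, hkill, zero_mul, hg0, map_zero]
      · by_cases hkS : k ∈ S
        · by_cases hkj : k = j
          · subst hkj
            rw [clean_subst_X_chart hbj hs, hkill, hgS k hkS, map_zero]
          · rw [clean_subst_X_fibre hbj hs hkS hkj, map_mul, map_mul, map_mul, hkill, zero_mul, hgS k hkS,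
              map_zero]
        · rw [clean_subst_X_base hs hkS, map_add, map_add, map_add, hbase k hkS, hC'ψ', hχC, ← map_add,
            ← Polynomial.C_add, hgb k hkS]
  -- the witness: `χ(x_{j'}) = t⁻¹ ∉ K[t]`
  refine not_isIntegral_quotient_comp_of_witness χ hker g hfac (a := X j'.succ) ?_
  rw [hχj', hι]
  exact inv_not_mem_range_algebraMap Polynomial.X_ne_zero Polynomial.not_isUnit_X

end DepthThree

end ChartDictionary

end Summit.ResolutionOfSingularities.ResolutionOfSingularities.Theorems.PIDim4

end
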